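import Literature.MathematicalPhysics.KineticTheory.LangevinChainScalingLimit
import Literature.MathematicalPhysics.KineticTheory.LangevinChainEnergyIdentity
import HarnessLib

/-!
# High-energy dissipation of the pinned chain along small-noise paths (CEHR Prop. 5.3, deterministic core)

Trunk T-KINETIC (Literature/MathematicalPhysics/KineticTheory). Cuneo–Eckmann–Hairer–Rey-Bellet,
EJP 23 (2018) no. 55, §5.1 (arXiv:1712.09413 pp. 24–30): Proposition 5.3 ("with a very large
probability, the average dissipation rate over the time interval `[0, τ(z₀)]` is at least some
fraction of the initial energy") is proved there by comparing the rescaled process (5.18)–(5.21) with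
the deterministic limiting system (5.32) through the Grönwall Lemma 5.8 (Lemma 5.17: the deviation
is at most `G_E + c E^{1/2ℓ_i - 3/4} η_E`, `η_E ∝ sup ‖W̃‖`), and using Proposition 5.14
(`∫₀^λ ∑_b γ_b p̂_b² ≥ C`). This file proves the DETERMINISTIC statement behind it for the pinned
anharmonic chain (`ω₂, lam, β > 0`, `γ ≥ 0`; `ℓ_i = ℓ_p = 4`), path by path, for the flow
`OscillatorChain.chainFlow` driven by an arbitrary continuous noise path `η`:

* `pinnedChain_sq_momentum_integral_lower_bound` — there are `Λ₀, ε₁, δ₀ > 0` and `a₀` such that for every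
  scale `a ≥ a₀` (energy `E = a⁴`), every time `τ ∈ [Λ₀/a, 2Λ₀/a]` (the natural time scale
  `E^{1/ℓ_i - 1/2} = a⁻¹` of (5.5)), every start `x` with `H(x) ∈ [a⁴/2, 2a⁴]`, and every continuous
  noise path with `η(0) = 0` and `‖η‖ ≤ δ₀ a²` on `[0, τ]` along which the energy stays `≤ 4a⁴`
  (the event `Ã` of Prop. 5.3): `∫₀^τ p_0(s)² ds ≥ ε₁ a⁴ τ`, whence the dissipation bound
  `Γ_τ ≥ γ ε₁ a⁴ τ` (`pinnedChain_dissipation_lower_bound`).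

Ingredients: the exact scaling identities and the limiting flow with CEHR Prop. 5.14
(`LangevinChainScalingLimit.lean`), the perturbation terms of (5.30) (`R̃ = O(a⁻²)` on bounded sets,
friction `γ a⁻¹ p̃`, noise `a⁻² η`), and the Grönwall comparison
`Literature.Analysis.ODE.IsIntegralSolutionOn.norm_sub_le_mul_exp` (CEHR Lemma 5.8), all in the
ORIGINAL time variable (the rescaled system runs at speed `a`).

## References

* N. Cuneo, J.-P. Eckmann, M. Hairer, L. Rey-Bellet, *Non-equilibrium steady states for networks of
  oscillators*, EJP 23 (2018) no. 55 (arXiv:1712.09413), Prop. 5.3, Lemma 5.8, §5.1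
  (5.18)–(5.33), Lemma 5.17 and the end of the proof of (5.19).
* L. Rey-Bellet, L. E. Thomas, CMP 225 (2002) 305–329, §3.2 (scaling and the deterministic limit).
-/

noncomputable section

open MeasureTheory Filter Topology Set Metric
open scoped NNReal

namespace Literature.MathematicalPhysics.KineticTheory.HeatConduction

open OscillatorChain Literature.Analysis.ODE

variable {N : ℕ}

/-! ### The quadratic (lower-order) part of the rescaled Hamiltonian and force -/

section Quadratic

variable (ω₂ lam β : ℝ)

/-- The **lower-order part** `Q(q) = ∑ ω₂ q_i²/2 + ∑_{bonds} (δq)²/2` of the rescaled potential: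
`Φ̃_ε = Φ̂ + ε Q`. [cite: CuneoEckmannHairerReyBellet2018, §5.1 eq. (5.20)] -/
def quadPart (N : ℕ) (q : Fin N → ℝ) : ℝ :=
  (∑ i, ω₂ * q i ^ 2 / 2) + ∑ i : Fin N, ∑ j : Fin N, if j.val = i.val + 1 then (q j - q i) ^ 2 / 2 else 0

/-- `H̃_ε = Ĥ + ε Q`. [cite: CuneoEckmannHairerReyBellet2018, §5.1 eq. (5.20) and (5.22)] -/
theorem scaledChain_hamiltonian_eq_add_quadPart (ε : ℝ) (N : ℕ) (v : PhaseSpace N) :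
    (scaledChain ω₂ lam β ε).hamiltonian N v =
      (scaledChain ω₂ lam β 0).hamiltonian N v + ε * quadPart ω₂ N v.1 := by
  unfold OscillatorChain.hamiltonian scaledChain quadPart
  simp only [zero_mul, zero_div, zero_add]
  rw [mul_add, Finset.mul_sum, Finset.mul_sum]
  have h1 : ∑ i, (v.2 i ^ 2 / 2 + (ε * ω₂ * v.1 i ^ 2 / 2 + lam * v.1 i ^ 4 / 4)) =
      ∑ i, (v.2 i ^ 2 / 2 + lam * v.1 i ^ 4 / 4) + ∑ i, ε * (ω₂ * v.1 i ^ 2 / 2) := by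
    rw [← Finset.sum_add_distrib]
    exact Finset.sum_congr rfl fun i _ => by ring
  have h2 : ∑ i : Fin N, ∑ j : Fin N, (if j.val = i.val + 1 then ε * (v.1 j - v.1 i) ^ 2 / 2 + β * (v.1 j - v.1 i) ^ 4 / 4 else 0) =
      ∑ i : Fin N, ∑ j : Fin N, (if j.val = i.val + 1 then β * (v.1 j - v.1 i) ^ 4 / 4 else 0) +
        ∑ i : Fin N, ε * ∑ j : Fin N, (if j.val = i.val + 1 then (v.1 j - v.1 i) ^ 2 / 2 else 0) := by
    rw [← Finset.sum_add_distrib]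
    refine Finset.sum_congr rfl fun i _ => ?_
    rw [Finset.mul_sum, ← Finset.sum_add_distrib]
    refine Finset.sum_congr rfl fun j _ => ?_
    split_ifs
    · ring
    · simp
  rw [h1, h2]
  ring

/-- `0 ≤ Q(q) ≤ N (|ω₂|/2 + 2) ‖q‖²` [folklore] -/
theorem quadPart_le (N : ℕ) (q : Fin N → ℝ) : quadPart ω₂ N q ≤ N * (|ω₂| / 2 + 2) * ‖q‖ ^ 2 := by
  unfold quadPart
  have hq : ∀ i, |q i| ≤ ‖q‖ := fun i => by rw [← Real.norm_eq_abs]; exact norm_le_pi_norm q i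
  have hq2 : ∀ i, q i ^ 2 ≤ ‖q‖ ^ 2 := fun i => by
    rw [← sq_abs]; exact pow_le_pow_left₀ (abs_nonneg _) (hq i) 2
  have h1 : ∑ i, ω₂ * q i ^ 2 / 2 ≤ N * (|ω₂| / 2 * ‖q‖ ^ 2) := by
    calc ∑ i, ω₂ * q i ^ 2 / 2 ≤ ∑ i : Fin N, |ω₂| / 2 * ‖q‖ ^ 2 := by
          refine Finset.sum_le_sum fun i _ => ?_
          have : ω₂ * q i ^ 2 / 2 ≤ |ω₂| * q i ^ 2 / 2 := by
            have := le_abs_self ω₂; nlinarith [sq_nonneg (q i)]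
          nlinarith [hq2 i, abs_nonneg ω₂]
      _ = N * (|ω₂| / 2 * ‖q‖ ^ 2) := by rw [Finset.sum_const, Finset.card_univ, Fintype.card_fin]; simp
  have h2 : ∑ i : Fin N, ∑ j : Fin N, (if j.val = i.val + 1 then (q j - q i) ^ 2 / 2 else 0) ≤ N * (2 * ‖q‖ ^ 2) := by
    have hinner : ∀ i : Fin N, ∑ j : Fin N, (if j.val = i.val + 1 then (q j - q i) ^ 2 / 2 else 0) ≤ 2 * ‖q‖ ^ 2 := by
      intro i
      by_cases hi : i.val + 1 < N
      · rw [Finset.sum_eq_single (⟨i.val + 1, hi⟩ : Fin N)]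
        · simp only [if_true]
          have ha := abs_le.1 (hq ⟨i.val + 1, hi⟩)
          have hb := abs_le.1 (hq i)
          nlinarith [norm_nonneg q]
        · intro j _ hj
          rw [if_neg]
          intro h; exact hj (Fin.ext h)
        · simp
      · rw [Finset.sum_eq_zero]
        · positivity
        · intro j _
          rw [if_neg]
          intro h; omega
    calc _ ≤ ∑ i : Fin N, 2 * ‖q‖ ^ 2 := Finset.sum_le_sum fun i _ => hinner i
      _ = N * (2 * ‖q‖ ^ 2) := by rw [Finset.sum_const, Finset.card_univ, Fintype.card_fin]; simp
  nlinarith [h1, h2]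

/-- `0 ≤ Q` when `ω₂ ≥ 0`. [folklore] -/
theorem quadPart_nonneg (hω : 0 ≤ ω₂) (N : ℕ) (q : Fin N → ℝ) : 0 ≤ quadPart ω₂ N q := by
  unfold quadPart
  refine add_nonneg (Finset.sum_nonneg fun i _ => by positivity)
    (Finset.sum_nonneg fun i _ => Finset.sum_nonneg fun j _ => ?_)
  split_ifs
  · positivity
  · exact le_rfl

/-- **The perturbation force** `R̃ = ∇(Φ̃_ε - Φ̂) = ε ∇Q` (CEHR (5.30)):
`∂_iΦ̃_ε - ∂_iΦ̂ = ε (ω₂ q_i + [0<i](q_i - q_{i-1}) - [i+1<N](q_{i+1} - q_i))`.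
[cite: CuneoEckmannHairerReyBellet2018, §5.1 eq. (5.30)] -/
theorem scaledChain_dPotential_sub (ε : ℝ) (N : ℕ) (i : Fin N) (q : Fin N → ℝ) :
    (scaledChain ω₂ lam β ε).dPotential N i q - (scaledChain ω₂ lam β 0).dPotential N i q =
      ε * (ω₂ * q i + (if h : 0 < i.val then (q i - q ⟨i.val - 1, by omega⟩) else 0) -
        (if h : i.val + 1 < N then (q ⟨i.val + 1, h⟩ - q i) else 0)) := by
  rw [(scaledChain ω₂ lam β ε).dPotential_eq_closed, (scaledChain ω₂ lam β 0).dPotential_eq_closed]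
  simp only [scaledChain_deriv_U, scaledChain_deriv_V, zero_mul, zero_add]
  split_ifs <;> ring

/-- `|R̃_i| ≤ |ε| (|ω₂| + 4) ‖q‖` (CEHR (5.31): `R̃ → 0` uniformly on `K̃_E`). [cite: CuneoEckmannHairerReyBellet2018, §5.1 eq. (5.31)] -/
theorem abs_scaledChain_dPotential_sub_le (ε : ℝ) (N : ℕ) (i : Fin N) (q : Fin N → ℝ) :
    |(scaledChain ω₂ lam β ε).dPotential N i q - (scaledChain ω₂ lam β 0).dPotential N i q| ≤
      |ε| * ((|ω₂| + 4) * ‖q‖) := by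
  rw [scaledChain_dPotential_sub, abs_mul]
  refine mul_le_mul_of_nonneg_left ?_ (abs_nonneg _)
  have hq : ∀ j, |q j| ≤ ‖q‖ := fun j => by rw [← Real.norm_eq_abs]; exact norm_le_pi_norm q j
  have h1 : |ω₂ * q i| ≤ |ω₂| * ‖q‖ := by rw [abs_mul]; exact mul_le_mul_of_nonneg_left (hq i) (abs_nonneg _)
  have h2 : |(if h : 0 < i.val then (q i - q ⟨i.val - 1, by omega⟩) else 0)| ≤ 2 * ‖q‖ := by
    split_ifs
    · calc _ ≤ |q i| + |q ⟨i.val - 1, by omega⟩| := abs_sub _ _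
        _ ≤ ‖q‖ + ‖q‖ := add_le_add (hq _) (hq _)
        _ = 2 * ‖q‖ := by ring
    · simp
  have h3 : |(if h : i.val + 1 < N then (q ⟨i.val + 1, h⟩ - q i) else 0)| ≤ 2 * ‖q‖ := by
    split_ifs
    · calc _ ≤ |q ⟨i.val + 1, by omega⟩| + |q i| := abs_sub _ _
        _ ≤ ‖q‖ + ‖q‖ := add_le_add (hq _) (hq _)
        _ = 2 * ‖q‖ := by ring
    · simp
  calc _ ≤ |ω₂ * q i + (if h : 0 < i.val then (q i - q ⟨i.val - 1, by omega⟩) else 0)| +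
        |(if h : i.val + 1 < N then (q ⟨i.val + 1, h⟩ - q i) else 0)| := abs_sub _ _
    _ ≤ (|ω₂ * q i| + |(if h : 0 < i.val then (q i - q ⟨i.val - 1, by omega⟩) else 0)|) +
        |(if h : i.val + 1 < N then (q ⟨i.val + 1, h⟩ - q i) else 0)| := by
        gcongr; exact abs_add_le _ _
    _ ≤ (|ω₂| * ‖q‖ + 2 * ‖q‖) + 2 * ‖q‖ := add_le_add (add_le_add h1 h2) h3
    _ = (|ω₂| + 4) * ‖q‖ := by ring

end Quadratic

/-! ### The scaling map as a continuous linear map -/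

namespace OscillatorChain

/-- `rescale a` as a continuous linear map (block-diagonal scalar). [folklore] -/
def rescaleCLM (N : ℕ) (a : ℝ) : PhaseSpace N →L[ℝ] PhaseSpace N :=
  (a⁻¹ • ContinuousLinearMap.fst ℝ (Fin N → ℝ) (Fin N → ℝ)).prod
    ((a ^ 2)⁻¹ • ContinuousLinearMap.snd ℝ (Fin N → ℝ) (Fin N → ℝ))

/-- The continuous linear map is `rescale`. [folklore] -/
@[simp] theorem rescaleCLM_apply (N : ℕ) (a : ℝ) (z : PhaseSpace N) : rescaleCLM N a z = rescale a z := by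
  ext i <;> simp [rescaleCLM, rescale]

/-- `rescale a` commutes with the time integral. [folklore] -/
theorem rescale_intervalIntegral (N : ℕ) (a : ℝ) {f : ℝ → PhaseSpace N} (hf : Continuous f) (s t : ℝ) :
    rescale a (∫ u in s..t, f u) = ∫ u in s..t, rescale a (f u) := by
  have h := (rescaleCLM N a).intervalIntegral_comp_comm (hf.intervalIntegrable (μ := volume) s t)
  simp only [rescaleCLM_apply] at h
  exact h.symm

/-- The norm of the momentum part of a rescaled point. [folklore] -/
theorem rescale_zero_momentum (N : ℕ) (a : ℝ) (e : Fin N → ℝ) :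
    rescale a (((0 : Fin N → ℝ), e) : PhaseSpace N) = ((0 : Fin N → ℝ), fun i => (a ^ 2)⁻¹ * e i) := by
  ext i <;> simp [rescale]

end OscillatorChain

/-! ### The rescaled drift (CEHR (5.21)/(5.30)) -/

section ScaledDrift

variable (ω₂ lam β γ : ℝ)

/-- **The rescaled drift**: for `a ≠ 0` and `ṽ = rescale a v`,
`rescale a (Y(v)) - a X_Ĥ(ṽ) = (0, -a (∇Φ̃_{a⁻²} - ∇Φ̂)(q̃) - γ w p̃)`, i.e. in the ORIGINAL time the
rescaled path moves with the limiting Hamiltonian field at speed `a`, plus the perturbation `a R̃`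
and the friction (the deterministic part of CEHR (5.30)).
[cite: CuneoEckmannHairerReyBellet2018, §5.1 eq. (5.21) and (5.30)] -/
theorem rescale_drift_sub {a : ℝ} (ha : a ≠ 0) (N : ℕ) (v : PhaseSpace N) :
    rescale a ((pinnedChain ω₂ lam β γ).drift N v) - a • (scaledChain ω₂ lam β 0).drift N (rescale a v) =
      ((0 : Fin N → ℝ), fun i =>
        -a * ((scaledChain ω₂ lam β (a ^ 2)⁻¹).dPotential N i (rescale a v).1 -
          (scaledChain ω₂ lam β 0).dPotential N i (rescale a v).1) -
        γ * bathWeight N i * (rescale a v).2 i) := by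
  rw [scaledChain_drift_apply, (pinnedChain ω₂ lam β γ).drift_eq
    ((pinnedChain_contDiff_U ω₂ lam β γ (n := 1)).differentiable one_ne_zero)
    ((pinnedChain_contDiff_V ω₂ lam β γ (n := 1)).differentiable one_ne_zero)]
  have hq : (rescale a v).1 = fun j => a⁻¹ * v.1 j := rfl
  refine Prod.ext (funext fun i => ?_) (funext fun i => ?_)
  · simp [rescale]
    field_simp
    ring
  · simp only [rescale_snd, Prod.snd_sub, Pi.sub_apply, Prod.smul_snd, Pi.smul_apply, smul_eq_mul]
    rw [hq, ← pinnedChain_dPotential_eq_scaled ω₂ lam β γ ha N i v.1]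
    show (a ^ 2)⁻¹ * (-(pinnedChain ω₂ lam β γ).dPotential N i v.1 - (pinnedChain ω₂ lam β γ).γ * bathWeight N i * v.2 i) -
        a * -(scaledChain ω₂ lam β 0).dPotential N i (fun j => a⁻¹ * v.1 j) =
      -a * ((a ^ 3)⁻¹ * (pinnedChain ω₂ lam β γ).dPotential N i v.1 -
          (scaledChain ω₂ lam β 0).dPotential N i (fun j => a⁻¹ * v.1 j)) -
        γ * bathWeight N i * ((a ^ 2)⁻¹ * v.2 i)
    have hγ : (pinnedChain ω₂ lam β γ).γ = γ := rfl
    rw [hγ]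
    field_simp
    ring

/-- **Size of the rescaled perturbation** on the ball of radius `R`:
`‖rescale a (Y(v)) - a X_Ĥ(ṽ)‖ ≤ a⁻¹ (|ω₂| + 4) R + 2|γ| R` when `‖ṽ‖ ≤ R`, `a ≥ 1`.
[cite: CuneoEckmannHairerReyBellet2018, §5.1 eq. (5.31)] -/
theorem norm_rescale_drift_sub_le {a : ℝ} (ha : 1 ≤ a) (N : ℕ) (v : PhaseSpace N) {R : ℝ}
    (hR : ‖rescale a v‖ ≤ R) :
    ‖rescale a ((pinnedChain ω₂ lam β γ).drift N v) - a • (scaledChain ω₂ lam β 0).drift N (rescale a v)‖ ≤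
      a⁻¹ * ((|ω₂| + 4) * R) + 2 * |γ| * R := by
  have ha0 : a ≠ 0 := by positivity
  have hR0 : 0 ≤ R := (norm_nonneg _).trans hR
  rw [rescale_drift_sub ω₂ lam β γ ha0, Prod.norm_def, norm_zero, max_eq_right (norm_nonneg _)]
  refine (pi_norm_le_iff_of_nonneg (by positivity)).2 fun i => ?_
  rw [Real.norm_eq_abs]
  dsimp only
  have hq : ‖(rescale a v).1‖ ≤ R := (norm_fst_le _).trans hR
  have hp : |(rescale a v).2 i| ≤ R := by
    rw [← Real.norm_eq_abs]
    exact ((norm_le_pi_norm _ i).trans (norm_snd_le _)).trans hR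
  have h1 := abs_scaledChain_dPotential_sub_le ω₂ lam β (a ^ 2)⁻¹ N i (rescale a v).1
  have hw0 := bathWeight_nonneg N i
  have hw2 := bathWeight_le_two N i
  have hε : |(a ^ 2)⁻¹| = (a ^ 2)⁻¹ := abs_of_pos (by positivity)
  calc |-a * ((scaledChain ω₂ lam β (a ^ 2)⁻¹).dPotential N i (rescale a v).1 -
          (scaledChain ω₂ lam β 0).dPotential N i (rescale a v).1) - γ * bathWeight N i * (rescale a v).2 i|
      ≤ |-a * ((scaledChain ω₂ lam β (a ^ 2)⁻¹).dPotential N i (rescale a v).1 -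
          (scaledChain ω₂ lam β 0).dPotential N i (rescale a v).1)| + |γ * bathWeight N i * (rescale a v).2 i| :=
        abs_sub _ _
    _ ≤ a * ((a ^ 2)⁻¹ * ((|ω₂| + 4) * R)) + |γ| * 2 * R := by
        refine add_le_add ?_ ?_
        · rw [abs_mul, abs_neg, abs_of_pos (by positivity)]
          refine mul_le_mul_of_nonneg_left (h1.trans ?_) (by positivity)
          rw [hε]
          exact mul_le_mul_of_nonneg_left (mul_le_mul_of_nonneg_left hq (by positivity)) (by positivity)
        · rw [abs_mul, abs_mul, abs_of_nonneg hw0]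
          calc |γ| * bathWeight N i * |(rescale a v).2 i| ≤ |γ| * 2 * R :=
                mul_le_mul (mul_le_mul_of_nonneg_left hw2 (abs_nonneg _)) hp (abs_nonneg _) (by positivity)
            _ = |γ| * 2 * R := rfl
    _ = a⁻¹ * ((|ω₂| + 4) * R) + 2 * |γ| * R := by field_simp

end ScaledDrift

/-! ### The comparison with the limiting system and the dissipation bound -/

section Main

variable {ω₂ lam β γ : ℝ} (hω : 0 < ω₂) (hl : 0 < lam) (hβ : 0 < β) (hγ : 0 ≤ γ) {N : ℕ}
include hω hl hβ hγ

-- the flows are limits of Picard iterations: never let the unifier unfold them (heartbeats)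
attribute [local irreducible] OscillatorChain.chainFlow limitFlow

omit hω hl hβ hγ in
/-- The scaled limiting field `v ↦ a X_Ĥ(v)` is Lipschitz on every ball. [folklore] -/
theorem lipschitzOnWith_smul_limitDrift {K : ℝ≥0} {R : ℝ}
    (hK : LipschitzOnWith K ((scaledChain ω₂ lam β 0).drift N) (closedBall 0 R)) {a : ℝ} (ha : 0 ≤ a) :
    LipschitzOnWith (a.toNNReal * K) (fun v => a • (scaledChain ω₂ lam β 0).drift N v) (closedBall 0 R) := by
  refine LipschitzOnWith.of_dist_le_mul fun v hv v' hv' => ?_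
  rw [dist_eq_norm, ← smul_sub, norm_smul, Real.norm_eq_abs, abs_of_nonneg ha, NNReal.coe_mul,
    Real.coe_toNNReal a ha, mul_assoc]
  refine mul_le_mul_of_nonneg_left ?_ ha
  rw [← dist_eq_norm]
  exact hK.dist_le_mul v hv v' hv'

omit hω hl hβ hγ in
/-- The pointwise inequality `u² ≥ v²/2 - (u - v)²`. [folklore] -/
theorem sq_ge_half_sq_sub (u v : ℝ) : v ^ 2 / 2 - (u - v) ^ 2 ≤ u ^ 2 := by
  nlinarith [sq_nonneg (u - v - v), sq_nonneg (2 * u - v)]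

/-- **The deterministic core of CEHR Proposition 5.3 for the pinned chain** (`ω₂, lam, β > 0`,
`γ ≥ 0`, `N ≥ 1`; `ℓ_i = ℓ_p = 4`). There are `Λ₀, ε₁, δ₀ > 0` and `a₀ ≥ 1` such that: for every
scale `a ≥ a₀`, every time horizon `τ ∈ [Λ₀/a, 2Λ₀/a]`, every start `x` with
`H(x) ∈ [a⁴/2, 2a⁴]`, and every continuous noise path `η` with `η(0) = 0` and `‖η(s)‖ ≤ δ₀ a²` on
`[0, τ]` along which `H(z(s)) ≤ 4a⁴` on `[0, τ]` (`z = chainFlow x η`), one has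
`∫₀^τ p_0(s)² ds ≥ ε₁ a⁴ τ`. Proof (CEHR §5.1 with `E = a⁴`): the rescaled path `w = rescale a ∘ z`
solves, in the original time, `w' = a X_Ĥ(w) + (a R̃(w) - γ𝟙_B p̃) + a⁻² η'` and stays in
`{H̃ ≤ 4} ⊆ B_R`; the limiting flow `ŵ(t) = ψ_{w(0)}(a t)` solves `ŵ' = a X_Ĥ(ŵ)` in `B_R`; Grönwall
(Lemma 5.8) over the time `τ ≤ 2Λ₀/a` with the Lipschitz constant `aK` gives
`‖w - ŵ‖ ≤ (δ₀ + C/a) e^{2KΛ₀}`; Prop. 5.14 gives `∫₀^{aτ} p̂_0² ≥ C₅₁₄` since `Ĥ(w(0)) ∈ [1/4, 2]`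
for `a` large (`H̃ = Ĥ + a⁻²Q`, (5.29)); and `p_0 = a² p̃_0`, `p̃_0² ≥ p̂_0²/2 - (p̃_0 - p̂_0)²`.
[cite: CuneoEckmannHairerReyBellet2018, Prop 5.3 (proof, §5.1: Lemma 5.17 and eq. (5.19))] -/
theorem pinnedChain_sq_momentum_integral_lower_bound (hN : 0 < N) :
    ∃ Λ₀ ε₁ δ₀ a₀ : ℝ, 0 < Λ₀ ∧ 0 < ε₁ ∧ 0 < δ₀ ∧ 1 ≤ a₀ ∧
      ∀ ⦃a : ℝ⦄, a₀ ≤ a → ∀ ⦃τ : ℝ⦄, Λ₀ / a ≤ τ → τ ≤ 2 * Λ₀ / a →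
        ∀ x : PhaseSpace N, a ^ 4 / 2 ≤ (pinnedChain ω₂ lam β γ).hamiltonian N x →
          (pinnedChain ω₂ lam β γ).hamiltonian N x ≤ 2 * a ^ 4 →
          ∀ ⦃η : ℝ → Fin N → ℝ⦄, Continuous η → η 0 = 0 → (∀ s ∈ Icc 0 τ, ‖η s‖ ≤ δ₀ * a ^ 2) →
            (∀ s ∈ Icc 0 τ, (pinnedChain ω₂ lam β γ).hamiltonian N
              ((pinnedChain ω₂ lam β γ).chainFlow N x η s) ≤ 4 * a ^ 4) →
              ε₁ * a ^ 4 * τ ≤ ∫ s in (0 : ℝ)..τ, ((pinnedChain ω₂ lam β γ).chainFlow N x η s).2 ⟨0, hN⟩ ^ 2 := by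
  set P := pinnedChain ω₂ lam β γ with hP
  set P0 := scaledChain ω₂ lam β 0 with hP0
  set R := limitRadius lam with hR
  have hR0 : 0 < R := limitRadius_pos lam
  -- Lipschitz constant of the limiting field on the ball
  obtain ⟨K, hK⟩ := exists_lipschitzOnWith_closedBall (scaledChain_contDiff_drift ω₂ lam β 0 N (n := 1)) R
  -- CEHR Prop. 5.14 on `[0, 1]` with `Ĥ ∈ [1/4, 2]`
  obtain ⟨C, hC0, hC⟩ := exists_pos_le_dissipation_limitFlow ω₂ hl hβ hN (Λ := 1) (h₁ := 1 / 4) (h₂ := 2)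
    one_pos (by norm_num) (by norm_num)
  -- constants
  set CQ : ℝ := N * (|ω₂| / 2 + 2) * R ^ 2 with hCQ
  set C₂ : ℝ := 2 * ((|ω₂| + 4) * R + 2 * |γ| * R) with hC₂
  set G : ℝ := Real.exp (2 * K) with hG
  set c₀ : ℝ := min 1 (C / 8) with hc₀
  set δ₀ : ℝ := c₀ / (2 * G) with hδ₀
  set a₀ : ℝ := max 1 (max (C₂ / δ₀) (4 * CQ + 1)) with ha₀
  have hCQ0 : 0 ≤ CQ := by positivity
  have hC₂0 : 0 ≤ C₂ := by positivity
  have hG1 : 1 ≤ G := Real.one_le_exp (by positivity)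
  have hc₀0 : 0 < c₀ := by positivity
  have hc₀1 : c₀ ≤ 1 := min_le_left _ _
  have hc₀C : c₀ ≤ C / 8 := min_le_right _ _
  have hδ₀0 : 0 < δ₀ := by positivity
  refine ⟨1, C / 8, δ₀, a₀, one_pos, by positivity, hδ₀0, le_max_left _ _, ?_⟩
  intro a ha τ hτ1 hτ2 x hx1 hx2 η hηc hη0 hηδ hE4
  -- elementary facts about the scale
  have ha1 : 1 ≤ a := (le_max_left _ _).trans ha
  have ha0 : 0 < a := one_pos.trans_le ha1
  have ha0' : a ≠ 0 := ha0.ne'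
  have haC : C₂ / δ₀ ≤ a := ((le_max_left _ _).trans (le_max_right _ _)).trans ha
  have haQ : 4 * CQ + 1 ≤ a := ((le_max_right _ _).trans (le_max_right _ _)).trans ha
  have hτ0 : 0 < τ := lt_of_lt_of_le (by positivity) hτ1
  have haτ : a * τ ≤ 2 := by
    have h := (le_div_iff₀ ha0).1 hτ2; linarith only [h]
  have haτ1 : 1 ≤ a * τ := by
    have h := (div_le_iff₀ ha0).1 hτ1; linarith only [h]
  set ε : ℝ := (a ^ 2)⁻¹ with hε
  have hε0 : 0 < ε := by positivity
  have hε1 : ε ≤ a⁻¹ := by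
    rw [hε, inv_le_inv₀ (by positivity) ha0]; exact le_self_pow₀ ha1 two_ne_zero
  set Pε := scaledChain ω₂ lam β ε with hPε
  -- the path, its rescaling and the limiting path
  set z := P.chainFlow N x η with hz
  have hzc : Continuous z := pinnedChain_continuous_chainFlow hω hl.le hβ.le hγ N x hηc
  have hz0 : z 0 = x := by
    rw [hz, pinnedChain_chainFlow_of_nonpos ω₂ lam β γ N x hηc le_rfl, hη0]
    simp
  set w : ℝ → PhaseSpace N := fun t => rescale a (z t) with hw
  have hwc : Continuous w := (continuous_rescale a).comp hzc
  have hw0 : w 0 = rescale a x := by simp [hw, hz0]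
  set w₀ := rescale a x with hw₀
  set ŵ : ℝ → PhaseSpace N := fun t => limitFlow ω₂ lam β N w₀ (a * t) with hŵ
  have hŵc : Continuous ŵ := (continuous_limitFlow ω₂ lam β N w₀).comp (continuous_const.mul continuous_id)
  -- energies in the rescaled picture
  have hscale : ∀ v : PhaseSpace N, P.hamiltonian N v = a ^ 4 * Pε.hamiltonian N (rescale a v) := fun v =>
    pinnedChain_hamiltonian_eq_scaled ω₂ lam β γ ha0' N v
  have ha4 : 0 < a ^ 4 := by positivity
  have hEw : ∀ s ∈ Icc 0 τ, Pε.hamiltonian N (w s) ≤ 4 := fun s hs => by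
    have h := hE4 s hs
    rw [hscale] at h
    exact le_of_mul_le_mul_left (by linarith only [h]) ha4
  have hEw0 : Pε.hamiltonian N w₀ ≤ 2 ∧ 1 / 2 ≤ Pε.hamiltonian N w₀ := by
    rw [hscale] at hx1 hx2
    constructor
    · exact le_of_mul_le_mul_left (by linarith only [hx2]) ha4
    · exact le_of_mul_le_mul_left (by linarith only [hx1]) ha4
  have hεω : 0 ≤ ε * ω₂ := by positivity
  have hnorm_w : ∀ s ∈ Icc 0 τ, ‖w s‖ ≤ R - 1 := fun s hs => by
    have h := scaledChain_norm_le_of_hamiltonian_le ω₂ lam β ε hε0.le hεω hl hβ.le N (hEw s hs)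
    rw [hR]; unfold limitRadius; linarith only [h]
  have hnorm_w0 : ‖w₀‖ ≤ R - 1 := by
    have h := scaledChain_norm_le_of_hamiltonian_le ω₂ lam β ε hε0.le hεω hl hβ.le N (h := 4)
      (hEw0.1.trans (by norm_num : (2 : ℝ) ≤ 4))
    rw [hR]; unfold limitRadius; linarith only [h]
  -- the limiting energy of the rescaled start is in `[1/4, 2]` (CEHR (5.29))
  have hsplit := scaledChain_hamiltonian_eq_add_quadPart ω₂ lam β ε N w₀
  rw [← hPε, ← hP0] at hsplit
  have hQ0 : 0 ≤ quadPart ω₂ N w₀.1 := quadPart_nonneg ω₂ hω.le N _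
  have hQ1 : quadPart ω₂ N w₀.1 ≤ CQ := by
    refine (quadPart_le ω₂ N w₀.1).trans ?_
    rw [hCQ]
    have : ‖w₀.1‖ ≤ R := (norm_fst_le w₀).trans (by linarith only [hnorm_w0])
    have h2 : ‖w₀.1‖ ^ 2 ≤ R ^ 2 := pow_le_pow_left₀ (norm_nonneg _) this 2
    exact mul_le_mul_of_nonneg_left h2 (by positivity)
  have hH0w0 : P0.hamiltonian N w₀ ∈ Icc (1 / 4 : ℝ) 2 := by
    constructor
    · have hεQ : ε * quadPart ω₂ N w₀.1 ≤ 1 / 4 := by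
        calc ε * quadPart ω₂ N w₀.1 ≤ a⁻¹ * CQ := mul_le_mul hε1 hQ1 hQ0 (by positivity)
          _ ≤ 1 / 4 := by
              rw [inv_mul_le_iff₀ ha0]; linarith only [haQ]
      linarith only [hsplit, hεQ, hEw0.2]
    · linarith only [hsplit, hEw0.1, mul_nonneg hε0.le hQ0]
  have hH0w0' : P0.hamiltonian N w₀ ≤ 4 := hH0w0.2.trans (by norm_num)
  have hnorm_ŵ : ∀ s, 0 ≤ s → ‖ŵ s‖ ≤ R - 1 := fun s hs =>
    norm_limitFlow_le ω₂ β hl hβ.le N hH0w0' (by positivity)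
  -- the integral equations
  set F : PhaseSpace N → PhaseSpace N := fun v => a • P0.drift N v with hF
  have hFlip : LipschitzOnWith (a.toNNReal * K) F (closedBall 0 R) := lipschitzOnWith_smul_limitDrift hK ha0.le
  have hYc : Continuous (P.drift N) := (pinnedChain_contDiff_drift ω₂ lam β γ N (n := 0)).continuous
  have hX0c : Continuous (P0.drift N) := (scaledChain_contDiff_drift ω₂ lam β 0 N (n := 0)).continuous
  set dd : ℝ → PhaseSpace N := fun s => rescale a (P.drift N (z s)) - a • P0.drift N (w s) with hdd
  have hddc : Continuous dd := ((continuous_rescale a).comp (hYc.comp hzc)).sub ((hX0c.comp hwc).const_smul a)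
  set g₁ : ℝ → PhaseSpace N := fun t => w₀ + rescale a (((0 : Fin N → ℝ), η t) : PhaseSpace N) +
    ∫ s in (0 : ℝ)..t, dd s with hg₁
  have hsol_w : IsIntegralSolutionOn F g₁ w τ := by
    intro t ht
    have hzt := pinnedChain_isIntegralSolutionOn_chainFlow hω hl.le hβ.le hγ N x hηc τ t ht
    simp only [hw, hg₁, hF, hdd]
    rw [← hz] at hzt
    have hYz : Continuous fun s => P.drift N (z s) := hYc.comp hzc
    rw [hzt, forcing, rescale_add, rescale_add, rescale_intervalIntegral N a hYz]
    have hFw : Continuous fun s => a • P0.drift N (w s) := (hX0c.comp hwc).const_smul a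
    have hsplit' : ∫ s in (0 : ℝ)..t, rescale a (P.drift N (z s)) =
        (∫ s in (0 : ℝ)..t, (rescale a (P.drift N (z s)) - a • P0.drift N (w s))) +
          ∫ s in (0 : ℝ)..t, a • P0.drift N (w s) := by
      rw [← intervalIntegral.integral_add (hddc.intervalIntegrable _ _) (hFw.intervalIntegrable _ _)]
      refine intervalIntegral.integral_congr fun s _ => ?_
      simp only [hdd, hw, sub_add_cancel]
    rw [hsplit']
    simp only [hw₀, hw]
    abel
  have hsol_ŵ : IsIntegralSolutionOn F (fun _ => w₀) ŵ τ := by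
    intro t ht
    simp only [hŵ, hF]
    have hat : 0 ≤ a * t := mul_nonneg ha0.le ht.1
    have h1 := limitFlow_eq_integral ω₂ β hl hβ.le N (x := w₀) hH0w0' hat
    refine h1.trans ?_
    congr 1
    have hsub : ∫ s in (0 : ℝ)..t, P0.drift N (limitFlow ω₂ lam β N w₀ (a * s)) =
        a⁻¹ • ∫ u in (0 : ℝ)..(a * t), P0.drift N (limitFlow ω₂ lam β N w₀ u) := by
      have h := intervalIntegral.integral_comp_mul_left (fun u => P0.drift N (limitFlow ω₂ lam β N w₀ u)) ha0'
        (a := 0) (b := t)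
      simp only [mul_zero] at h
      exact h
    rw [intervalIntegral.integral_smul, hsub, smul_smul, mul_inv_cancel₀ ha0', one_smul]
  -- the forcing difference
  have hforce : ∀ t ∈ Icc 0 τ, ‖g₁ t - w₀‖ ≤ δ₀ + C₂ / a := by
    intro t ht
    have hform : g₁ t - w₀ = rescale a (((0 : Fin N → ℝ), η t) : PhaseSpace N) + ∫ s in (0 : ℝ)..t, dd s := by
      simp only [hg₁]; abel
    rw [hform]
    refine (norm_add_le _ _).trans (add_le_add ?_ ?_)
    · rw [rescale_zero_momentum, Prod.norm_def, norm_zero, max_eq_right (norm_nonneg _)]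
      refine (pi_norm_le_iff_of_nonneg hδ₀0.le).2 fun i => ?_
      rw [norm_mul, norm_inv, norm_pow, Real.norm_eq_abs, abs_of_pos ha0]
      have h1 : ‖η t i‖ ≤ δ₀ * a ^ 2 := (norm_le_pi_norm (η t) i).trans (hηδ t ht)
      calc (a ^ 2)⁻¹ * ‖η t i‖ ≤ (a ^ 2)⁻¹ * (δ₀ * a ^ 2) := mul_le_mul_of_nonneg_left h1 (by positivity)
        _ = δ₀ := by field_simp
    · have hbound : ∀ s ∈ Set.uIoc (0 : ℝ) t, ‖dd s‖ ≤ a⁻¹ * ((|ω₂| + 4) * R) + 2 * |γ| * R := by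
        intro s hs
        rw [uIoc_of_le ht.1] at hs
        exact norm_rescale_drift_sub_le ω₂ lam β γ ha1 N (z s) ((hnorm_w s ⟨hs.1.le, hs.2.trans ht.2⟩).trans (by linarith only))
      refine (intervalIntegral.norm_integral_le_of_norm_le_const hbound).trans ?_
      rw [abs_of_nonneg (by linarith only [ht.1] : (0 : ℝ) ≤ t - 0)]
      have ht' : t - 0 ≤ 2 / a := by
        have := ht.2.trans hτ2; simpa using this
      calc (a⁻¹ * ((|ω₂| + 4) * R) + 2 * |γ| * R) * (t - 0)
          ≤ ((|ω₂| + 4) * R + 2 * |γ| * R) * (2 / a) := by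
            refine mul_le_mul ?_ ht' (by linarith only [ht.1]) (by positivity)
            have : a⁻¹ * ((|ω₂| + 4) * R) ≤ (|ω₂| + 4) * R := by
              rw [inv_mul_le_iff₀ ha0]; exact le_mul_of_one_le_left (by positivity) ha1
            linarith only [this]
        _ = C₂ / a := by rw [hC₂]; field_simp
  have hδ : δ₀ + C₂ / a ≤ 2 * δ₀ := by
    have h1 : C₂ / a ≤ δ₀ := by
      rw [div_le_iff₀ ha0]
      have h2 := (div_le_iff₀ hδ₀0).1 haC
      linarith only [h2]
    linarith only [h1]
  -- Grönwall (CEHR Lemma 5.8)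
  have hdev : ∀ t ∈ Icc 0 τ, ‖w t - ŵ t‖ ≤ 2 * δ₀ * G := by
    intro t ht
    have h := hsol_w.norm_sub_le_mul_exp hFlip hsol_ŵ hwc hŵc
      (fun s hs => mem_closedBall_zero_iff.2 ((hnorm_w s hs).trans (by linarith only)))
      (fun s hs => mem_closedBall_zero_iff.2 ((hnorm_ŵ s hs.1).trans (by linarith only))) hforce t ht
    refine h.trans ?_
    rw [NNReal.coe_mul, Real.coe_toNNReal a ha0.le]
    have hexp : Real.exp (a * K * t) ≤ G := by
      rw [hG]
      refine Real.exp_le_exp.2 ?_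
      have hat2 : a * t ≤ 2 := (mul_le_mul_of_nonneg_left ht.2 ha0.le).trans haτ
      calc a * K * t = K * (a * t) := by ring
        _ ≤ K * 2 := mul_le_mul_of_nonneg_left hat2 K.coe_nonneg
        _ = 2 * K := by ring
    calc (δ₀ + C₂ / a) * Real.exp (a * K * t) ≤ (2 * δ₀) * G :=
          mul_le_mul hδ hexp (Real.exp_pos _).le (by positivity)
      _ = 2 * δ₀ * G := by ring
  have hD : (2 * δ₀ * G) ^ 2 ≤ C / 8 := by
    have : 2 * δ₀ * G = c₀ := by rw [hδ₀]; field_simp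
    rw [this]
    nlinarith only [hc₀0, hc₀1, hc₀C]
  -- the dissipation of the limiting path (Prop. 5.14 after the time change `u = a s`)
  set i₀ : Fin N := ⟨0, hN⟩ with hi₀
  have hψc : Continuous fun u => (limitFlow ω₂ lam β N w₀ u).2 i₀ ^ 2 :=
    ((continuous_apply i₀).comp (continuous_snd.comp (continuous_limitFlow ω₂ lam β N w₀))).pow 2
  have hlim_diss : C / a ≤ ∫ s in (0 : ℝ)..τ, (ŵ s).2 i₀ ^ 2 := by
    have hsub := intervalIntegral.integral_comp_mul_left (fun u => (limitFlow ω₂ lam β N w₀ u).2 i₀ ^ 2) ha0' (a := 0) (b := τ)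
    simp only [mul_zero] at hsub
    simp only [hŵ]
    rw [hsub, smul_eq_mul]
    have h514 := hC w₀ hH0w0
    have hmono : ∫ u in (0 : ℝ)..1, (limitFlow ω₂ lam β N w₀ u).2 i₀ ^ 2 ≤
        ∫ u in (0 : ℝ)..(a * τ), (limitFlow ω₂ lam β N w₀ u).2 i₀ ^ 2 :=
      intervalIntegral.integral_mono_interval le_rfl zero_le_one haτ1
        (Eventually.of_forall fun u => sq_nonneg _) (hψc.intervalIntegrable _ _)
    rw [div_eq_inv_mul]
    exact mul_le_mul_of_nonneg_left (h514.trans hmono) (by positivity)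
  -- compare the dissipations of `w` and `ŵ`
  have hwi : Continuous fun s => (w s).2 i₀ ^ 2 := ((continuous_apply i₀).comp (continuous_snd.comp hwc)).pow 2
  have hŵi : Continuous fun s => (ŵ s).2 i₀ ^ 2 := ((continuous_apply i₀).comp (continuous_snd.comp hŵc)).pow 2
  have hcomp : (∫ s in (0 : ℝ)..τ, (ŵ s).2 i₀ ^ 2) / 2 - (2 * δ₀ * G) ^ 2 * τ ≤ ∫ s in (0 : ℝ)..τ, (w s).2 i₀ ^ 2 := by
    have h1 : ∫ s in (0 : ℝ)..τ, ((ŵ s).2 i₀ ^ 2 / 2 - (2 * δ₀ * G) ^ 2) ≤ ∫ s in (0 : ℝ)..τ, (w s).2 i₀ ^ 2 := by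
      refine intervalIntegral.integral_mono_on hτ0.le ((hŵi.div_const 2).sub continuous_const |>.intervalIntegrable _ _)
        (hwi.intervalIntegrable _ _) fun s hs => ?_
      have hd := hdev s hs
      have hcomp' : |(w s).2 i₀ - (ŵ s).2 i₀| ≤ 2 * δ₀ * G := by
        rw [← Real.norm_eq_abs]
        have : (w s).2 i₀ - (ŵ s).2 i₀ = (w s - ŵ s).2 i₀ := by simp
        rw [this]
        exact ((norm_le_pi_norm _ i₀).trans (norm_snd_le _)).trans hd
      have hsq : ((w s).2 i₀ - (ŵ s).2 i₀) ^ 2 ≤ (2 * δ₀ * G) ^ 2 := by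
        rw [← sq_abs]; exact pow_le_pow_left₀ (abs_nonneg _) hcomp' 2
      linarith only [hsq, sq_ge_half_sq_sub ((w s).2 i₀) ((ŵ s).2 i₀)]
    rw [intervalIntegral.integral_sub ((hŵi.div_const 2).intervalIntegrable _ _) (continuous_const.intervalIntegrable _ _),
      intervalIntegral.integral_const, smul_eq_mul, intervalIntegral.integral_div] at h1
    linarith only [h1]
  -- unscale: `p_0 = a² p̃_0`
  have hunscale : ∫ s in (0 : ℝ)..τ, (z s).2 i₀ ^ 2 = a ^ 4 * ∫ s in (0 : ℝ)..τ, (w s).2 i₀ ^ 2 := by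
    rw [← intervalIntegral.integral_const_mul]
    refine intervalIntegral.integral_congr fun s _ => ?_
    simp only [hw, rescale_snd]
    field_simp
  -- conclusion
  rw [hunscale]
  have hmain : C / (4 * a) ≤ ∫ s in (0 : ℝ)..τ, (w s).2 i₀ ^ 2 := by
    have h1 : (2 * δ₀ * G) ^ 2 * τ ≤ C / (4 * a) := by
      calc (2 * δ₀ * G) ^ 2 * τ ≤ (C / 8) * (2 / a) := by
            refine mul_le_mul hD ?_ hτ0.le (by positivity)
            simpa using hτ2
        _ = C / (4 * a) := by field_simp; ring
    have h2 : C / a / 2 ≤ (∫ s in (0 : ℝ)..τ, (ŵ s).2 i₀ ^ 2) / 2 := by linarith only [hlim_diss]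
    have h3 : C / a / 2 = C / (4 * a) + C / (4 * a) := by field_simp; ring
    linarith only [h1, h2, h3, hcomp]
  calc C / 8 * a ^ 4 * τ ≤ C / 8 * a ^ 4 * (2 / a) := by
        refine mul_le_mul_of_nonneg_left ?_ (by positivity)
        simpa using hτ2
    _ = a ^ 4 * (C / (4 * a)) := by field_simp; ring
    _ ≤ a ^ 4 * ∫ s in (0 : ℝ)..τ, (w s).2 i₀ ^ 2 := mul_le_mul_of_nonneg_left hmain ha4.le

/-- **The dissipation form** (CEHR Prop. 5.3, deterministic core): under the same circumstances,
`Γ_τ ≥ γ ε₁ a⁴ τ` for the dissipation functional `Γ` of `LangevinChainEnergyIdentity.lean` (the bath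
site `0` carries weight `≥ 1`). [cite: CuneoEckmannHairerReyBellet2018, Prop 5.3] -/
theorem pinnedChain_dissipation_lower_bound (hN : 0 < N) :
    ∃ Λ₀ ε₁ δ₀ a₀ : ℝ, 0 < Λ₀ ∧ 0 < ε₁ ∧ 0 < δ₀ ∧ 1 ≤ a₀ ∧
      ∀ ⦃a : ℝ⦄, a₀ ≤ a → ∀ ⦃τ : ℝ⦄, Λ₀ / a ≤ τ → τ ≤ 2 * Λ₀ / a →
        ∀ x : PhaseSpace N, a ^ 4 / 2 ≤ (pinnedChain ω₂ lam β γ).hamiltonian N x →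
          (pinnedChain ω₂ lam β γ).hamiltonian N x ≤ 2 * a ^ 4 →
          ∀ ⦃η : ℝ → Fin N → ℝ⦄, Continuous η → η 0 = 0 → (∀ s ∈ Icc 0 τ, ‖η s‖ ≤ δ₀ * a ^ 2) →
            (∀ s ∈ Icc 0 τ, (pinnedChain ω₂ lam β γ).hamiltonian N
              ((pinnedChain ω₂ lam β γ).chainFlow N x η s) ≤ 4 * a ^ 4) →
              γ * (ε₁ * a ^ 4 * τ) ≤ (pinnedChain ω₂ lam β γ).dissipation N x η τ := by
  obtain ⟨Λ₀, ε₁, δ₀, a₀, hΛ₀, hε₁, hδ₀, ha₀, h⟩ := pinnedChain_sq_momentum_integral_lower_bound hω hl hβ hγ hN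
  refine ⟨Λ₀, ε₁, δ₀, a₀, hΛ₀, hε₁, hδ₀, ha₀, ?_⟩
  intro a ha τ hτ1 hτ2 x hx1 hx2 η hηc hη0 hηδ hE4
  have hmain := h ha hτ1 hτ2 x hx1 hx2 hηc hη0 hηδ hE4
  have ha0 : 0 < a := one_pos.trans_le (ha₀.trans ha)
  have hτ0 : 0 ≤ τ := le_trans (by positivity) hτ1
  unfold OscillatorChain.dissipation
  refine mul_le_mul_of_nonneg_left (hmain.trans ?_) hγ
  have hzc := pinnedChain_continuous_chainFlow hω hl.le hβ.le hγ N x hηc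
  refine intervalIntegral.integral_mono_on hτ0
    ((((continuous_apply _).comp (continuous_snd.comp hzc)).pow 2).intervalIntegrable _ _)
    ((continuous_finsetSum _ fun i _ => continuous_const.mul
      (((continuous_apply i).comp (continuous_snd.comp hzc)).pow 2)).intervalIntegrable _ _) fun s _ => ?_
  have hw : (1 : ℝ) ≤ bathWeight N ⟨0, hN⟩ := by
    unfold bathWeight; simp only [if_true]; split_ifs <;> norm_num
  calc ((pinnedChain ω₂ lam β γ).chainFlow N x η s).2 ⟨0, hN⟩ ^ 2
      ≤ bathWeight N ⟨0, hN⟩ * ((pinnedChain ω₂ lam β γ).chainFlow N x η s).2 ⟨0, hN⟩ ^ 2 :=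
        le_mul_of_one_le_left (sq_nonneg _) hw
    _ ≤ ∑ i, bathWeight N i * ((pinnedChain ω₂ lam β γ).chainFlow N x η s).2 i ^ 2 :=
        Finset.single_le_sum (f := fun i => bathWeight N i * ((pinnedChain ω₂ lam β γ).chainFlow N x η s).2 i ^ 2)
          (fun i _ => mul_nonneg (bathWeight_nonneg N i) (sq_nonneg _)) (Finset.mem_univ _)

end Main

end Literature.MathematicalPhysics.KineticTheory.HeatConduction
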